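import Summits.QuantumAdvantage.QuantumAdvantage.Theorems.LinnikCubicClassGroupsDegreeOnePrimesEscapeOneSidedFrobenius
import Literature.NumberTheory.GaloisRepresentations.FrobeniusDensityTheorem
import HarnessLib

/-!
# Frobenius divisions: the Möbius count of the primes whose Frobenius generates a given cyclic subgroup

Topic `Summits/QuantumAdvantage/QuantumAdvantage/Theorems`, cell B2b-1 (linnik-cubic), PART A (gen 9);
helper toward the crux `DegreeOnePrimesEscape` (stmt-QuantumAdvantage-11543) of route
`LinnikCubicClassGroups`.  HONEST FRAMING: the value of this file is a THEOREM (kernel-checked group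
theory and prime bookkeeping) — NOT summit progress.

Let `N/ℚ` be a Galois number field with group `G`, `σ ∈ G` of order `m`, and for `d ∣ m` let
`H_d = ⟨σ^d⟩` (order `m/d`) with fixed field `E_d = N^{H_d}`.  The **division** of `σ` is the set of
`g ∈ G` generating a conjugate of `⟨σ⟩`.  Frobenius' device (1896) for counting the primes whose
Frobenius lies in the division of `σ` with DEDEKIND ZETA FUNCTIONS ONLY is the Möbius identity

  `Σ_{d ∣ m} μ(d) · 𝟙[z ∈ H_d] = 𝟙[⟨z⟩ = ⟨σ⟩]`  (`z ∈ G`; `sum_moebius_ite_mem_zpowers_pow`),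

whence `Σ_{d ∣ m} μ(d) · #{g : g z g⁻¹ ∈ H_d} = #{g : ⟨g z g⁻¹⟩ = ⟨σ⟩}` (`sum_moebius_card_conj`); by
Perlis' unramified dictionary `|H_d| · a_{E_d}(p) = #{g : g φ_p g⁻¹ ∈ H_d}` this gives, at `p ∤ d_N`,
`Σ_{d ∣ m} (μ(d)/d) · a_{E_d}(p) = (1/m) · #{g : ⟨g φ_p g⁻¹⟩ = ⟨σ⟩}` (`divisionWeight_eq`), and summed
against `log p` (`division_sum_le`):
`Σ_{d ∣ m} (μ(d)/d) θ¹_{E_d}(x) − n² log|d_N| ≤ n² · Σ_{p ≤ x, p ∤ d_N, Frob_p generates a conjugate of ⟨σ⟩} log p`.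
The mean `Σ_z #{g : g z g⁻¹ ∈ H} = |G||H|` gives `Σ_{d ∣ m} μ(d)/d ≥ 1/(m|G|)` (`sum_moebius_div_ge`).

(The qualitative density statement is the tree's `FrobeniusDensityTheorem.lean`, whose Möbius lemmas are
reused.)  References: G. Frobenius, S.-B. Preuss. Akad. Wiss. (1896) 689–703 [folklore];
J. C. Lagarias, H. L. Montgomery, A. M. Odlyzko, Invent. Math. 54 (1979) [LagariasMontgomeryOdlyzko1979];
R. Perlis, J. Number Theory 9 (1977) [Perlis1977].
-/

noncomputable section

open scoped NumberField nonZeroDivisors ArithmeticFunction.Moebius ArithmeticFunction.zeta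
open Finset Real Ideal NumberField
open Literature.NumberTheory.NumberFields Literature.NumberTheory.LFunctions
  Literature.NumberTheory.LFunctions.NumberField

namespace Summit.QuantumAdvantage.QuantumAdvantage.Theorems.DegreeOnePrimesEscape

/-! ### Group theory: the Möbius indicator of the generators of `⟨σ⟩` -/

section GroupTheory

variable {G : Type*} [Group G] [Fintype G]

/-- For `z ∈ ⟨σ⟩` and `d ∣ m = ord σ`: `z ∈ ⟨σ^d⟩ ↔ ord z ∣ m/d`. -/
theorem mem_zpowers_pow_iff_orderOf_dvd {σ z : G} (hz : z ∈ Subgroup.zpowers σ) {d : ℕ}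
    (hd : d ∣ orderOf σ) (hd0 : d ≠ 0) :
    z ∈ Subgroup.zpowers (σ ^ d) ↔ orderOf z ∣ orderOf σ / d := by
  constructor
  · intro h
    rw [← orderOf_pow_of_dvd hd0 hd]
    exact orderOf_dvd_of_mem_zpowers h
  · intro h
    obtain ⟨j, hj⟩ := ((isOfFinOrder_of_finite σ).mem_powers_iff_mem_zpowers).mpr hz
    have hj' : σ ^ j = z := hj
    have hm0 : 0 < orderOf σ / d := Nat.div_pos (Nat.le_of_dvd (orderOf_pos σ) hd) (Nat.pos_of_ne_zero hd0)
    have h1 : z ^ (orderOf σ / d) = 1 := orderOf_dvd_iff_pow_eq_one.mp h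
    rw [← hj', ← pow_mul] at h1
    have h2 : orderOf σ ∣ j * (orderOf σ / d) := orderOf_dvd_iff_pow_eq_one.mpr h1
    have h3 : d * (orderOf σ / d) ∣ j * (orderOf σ / d) := by rwa [Nat.mul_div_cancel' hd]
    obtain ⟨i, hi⟩ := Nat.dvd_of_mul_dvd_mul_right hm0 h3
    rw [← hj', hi, pow_mul]
    exact Subgroup.pow_mem _ (Subgroup.mem_zpowers _) i

/-- For `z ∈ ⟨σ⟩`: `⟨z⟩ = ⟨σ⟩ ↔ ord z = ord σ`. -/
theorem zpowers_eq_zpowers_iff_orderOf_eq {σ z : G} (hz : z ∈ Subgroup.zpowers σ) :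
    Subgroup.zpowers z = Subgroup.zpowers σ ↔ orderOf z = orderOf σ := by
  constructor
  · intro h
    rw [← Nat.card_zpowers, ← Nat.card_zpowers, h]
  · intro h
    apply Subgroup.eq_of_le_of_card_ge (Subgroup.zpowers_le.mpr hz)
    rw [Nat.card_zpowers, Nat.card_zpowers, h]

/-- **Frobenius' Möbius identity**: `Σ_{d ∣ ord σ} μ(d) · 𝟙[z ∈ ⟨σ^d⟩] = 𝟙[⟨z⟩ = ⟨σ⟩]`. -/
theorem sum_moebius_ite_mem_zpowers_pow (σ z : G) [∀ d : ℕ, Decidable (z ∈ Subgroup.zpowers (σ ^ d))]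
    [Decidable (Subgroup.zpowers z = Subgroup.zpowers σ)] :
    ∑ d ∈ (orderOf σ).divisors,
        (ArithmeticFunction.moebius d : ℤ) * (if z ∈ Subgroup.zpowers (σ ^ d) then 1 else 0) =
      if Subgroup.zpowers z = Subgroup.zpowers σ then 1 else 0 := by
  set m : ℕ := orderOf σ with hm
  have hm0 : m ≠ 0 := (orderOf_pos σ).ne'
  by_cases hz : z ∈ Subgroup.zpowers σ
  · set k : ℕ := orderOf z with hk
    have hkm : k ∣ m := orderOf_dvd_of_mem_zpowers hz
    have hk0 : k ≠ 0 := (orderOf_pos z).ne'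
    -- `z ∈ ⟨σ^d⟩ ↔ k ∣ m/d ↔ d ∣ m/k`
    have hiff : ∀ d ∈ m.divisors, (z ∈ Subgroup.zpowers (σ ^ d) ↔ d ∣ m / k) := by
      intro d hd
      have hdm : d ∣ m := Nat.dvd_of_mem_divisors hd
      have hd0 : d ≠ 0 := Nat.pos_iff_ne_zero.mp (Nat.pos_of_mem_divisors hd)
      rw [mem_zpowers_pow_iff_orderOf_dvd hz hdm hd0, Nat.dvd_div_iff_mul_dvd hdm,
        Nat.dvd_div_iff_mul_dvd hkm, mul_comm]
    have hsum : ∑ d ∈ m.divisors,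
        (ArithmeticFunction.moebius d : ℤ) * (if z ∈ Subgroup.zpowers (σ ^ d) then 1 else 0) =
        ∑ d ∈ (m / k).divisors, (ArithmeticFunction.moebius d : ℤ) := by
      rw [← Finset.sum_filter_of_ne (p := fun d => d ∣ m / k)]
      · have hfilt : m.divisors.filter (fun d => d ∣ m / k) = (m / k).divisors := by
          ext d
          simp only [Finset.mem_filter, Nat.mem_divisors]
          constructor
          · rintro ⟨⟨-, -⟩, h2⟩
            exact ⟨h2, (Nat.div_pos (Nat.le_of_dvd (Nat.pos_of_ne_zero hm0) hkm) (Nat.pos_of_ne_zero hk0)).ne'⟩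
          · rintro ⟨h1, -⟩
            exact ⟨⟨h1.trans (Nat.div_dvd_of_dvd hkm), hm0⟩, h1⟩
        rw [hfilt]
        refine Finset.sum_congr rfl fun d hd => ?_
        have hd' : d ∈ m.divisors := by
          rw [Nat.mem_divisors] at hd ⊢
          exact ⟨hd.1.trans (Nat.div_dvd_of_dvd hkm), hm0⟩
        rw [if_pos ((hiff d hd').mpr (Nat.dvd_of_mem_divisors hd)), mul_one]
      · intro d hd hne
        by_contra hnd
        rw [if_neg (fun h => hnd ((hiff d hd).mp h)), mul_zero] at hne
        exact hne rfl
    rw [hsum, Literature.NumberTheory.GaloisRepresentations.sum_divisors_intCast_moebius_eq_ite]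
    have hiff' : (m / k = 1) ↔ (k = m) := by
      refine ⟨fun h => ?_, fun h => by rw [h, Nat.div_self (Nat.pos_of_ne_zero hm0)]⟩
      have := Nat.div_mul_cancel hkm
      rwa [h, one_mul] at this
    have hiff'' : Subgroup.zpowers z = Subgroup.zpowers σ ↔ k = m := zpowers_eq_zpowers_iff_orderOf_eq hz
    by_cases hkm' : k = m
    · rw [if_pos (hiff'.mpr hkm'), if_pos (hiff''.mpr hkm')]
    · rw [if_neg (fun h => hkm' (hiff'.mp h)), if_neg (fun h => hkm' (hiff''.mp h))]
  · have h0 : ∀ d ∈ m.divisors, (if z ∈ Subgroup.zpowers (σ ^ d) then (1 : ℤ) else 0) = 0 := by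
      intro d _
      rw [if_neg]
      intro h
      exact hz (Subgroup.zpowers_le.mpr (Subgroup.pow_mem _ (Subgroup.mem_zpowers σ) d) h)
    rw [Finset.sum_eq_zero fun d hd => by rw [h0 d hd, mul_zero], if_neg]
    intro h
    exact hz (h ▸ Subgroup.mem_zpowers z)

omit [Group G] in
/-- `#{g : P g}` as a sum of indicators. -/
theorem natCard_subtype_eq_sum_ite (P : G → Prop) [DecidablePred P] :
    (Nat.card {g : G // P g} : ℤ) = ∑ g : G, (if P g then 1 else 0 : ℤ) := by
  rw [Nat.card_eq_fintype_card, Fintype.card_subtype, Finset.natCast_card_filter]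

/-- **The division count**: `Σ_{d ∣ ord σ} μ(d) · #{g : g z g⁻¹ ∈ ⟨σ^d⟩} = #{g : ⟨g z g⁻¹⟩ = ⟨σ⟩}`. -/
theorem sum_moebius_card_conj (σ z : G) :
    ∑ d ∈ (orderOf σ).divisors, (ArithmeticFunction.moebius d : ℤ) *
        (Nat.card {g : G // g * z * g⁻¹ ∈ Subgroup.zpowers (σ ^ d)} : ℤ) =
      (Nat.card {g : G // Subgroup.zpowers (g * z * g⁻¹) = Subgroup.zpowers σ} : ℤ) := by
  classical
  simp_rw [natCard_subtype_eq_sum_ite, Finset.mul_sum]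
  rw [Finset.sum_comm]
  exact Finset.sum_congr rfl fun g _ => sum_moebius_ite_mem_zpowers_pow σ (g * z * g⁻¹)

/-- **The mean of a permutation character**: `Σ_{z ∈ G} #{g : g z g⁻¹ ∈ H} = |G| · |H|`. -/
theorem sum_card_conj_mem (H : Subgroup G) :
    ∑ z : G, (Nat.card {g : G // g * z * g⁻¹ ∈ H} : ℤ) = Nat.card G * Nat.card H := by
  classical
  have hinner : ∀ g : G, ∑ z : G, (if g * z * g⁻¹ ∈ H then (1 : ℤ) else 0) = Nat.card H := by
    intro g
    have e : {z : G // g * z * g⁻¹ ∈ H} ≃ H :=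
      { toFun := fun z => ⟨g * z.1 * g⁻¹, z.2⟩
        invFun := fun h => ⟨g⁻¹ * h.1 * g, by
          have : g * (g⁻¹ * (h : G) * g) * g⁻¹ = h := by group
          rw [this]; exact h.2⟩
        left_inv := fun z => Subtype.ext (by group)
        right_inv := fun h => Subtype.ext (by group) }
    rw [← natCard_subtype_eq_sum_ite, Nat.card_congr e]
  calc ∑ z : G, (Nat.card {g : G // g * z * g⁻¹ ∈ H} : ℤ)
      = ∑ z : G, ∑ g : G, (if g * z * g⁻¹ ∈ H then (1 : ℤ) else 0) :=
        Finset.sum_congr rfl fun z _ => natCard_subtype_eq_sum_ite _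
    _ = ∑ g : G, ∑ z : G, (if g * z * g⁻¹ ∈ H then (1 : ℤ) else 0) := Finset.sum_comm
    _ = ∑ _g : G, (Nat.card H : ℤ) := Finset.sum_congr rfl fun g _ => hinner g
    _ = Nat.card G * Nat.card H := by
        rw [Finset.sum_const, Finset.card_univ, nsmul_eq_mul, Nat.card_eq_fintype_card (α := G)]

omit [Fintype G] in
/-- `|⟨σ^d⟩| = ord σ / d` for `d ∣ ord σ`, `d ≠ 0`. -/
theorem natCard_zpowers_pow {σ : G} {d : ℕ} (hd : d ∣ orderOf σ) (hd0 : d ≠ 0) :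
    Nat.card (Subgroup.zpowers (σ ^ d)) = orderOf σ / d := by
  rw [Nat.card_zpowers, orderOf_pow_of_dvd hd0 hd]

/-- **Positivity of the Möbius mass**: `|G| · Σ_{d ∣ m} μ(d)/d = (1/m) Σ_z #{g : ⟨g z g⁻¹⟩ = ⟨σ⟩} ≥ 1/m`,
so `Σ_{d ∣ m} μ(d)/d ≥ 1/(m |G|)` (`m = ord σ`). -/
theorem sum_moebius_div_ge (σ : G) :
    1 / ((orderOf σ : ℝ) * Nat.card G) ≤
      ∑ d ∈ (orderOf σ).divisors, (ArithmeticFunction.moebius d : ℝ) / d := by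
  classical
  set m : ℕ := orderOf σ with hm
  have hm0 : (0 : ℝ) < m := by exact_mod_cast orderOf_pos σ
  have hG0 : (0 : ℝ) < Nat.card G := by exact_mod_cast (Nat.card_pos (α := G))
  -- `Σ_z Σ_d μ(d) #{g : g z g⁻¹ ∈ H_d} = |G| Σ_d μ(d) |H_d| = |G| Σ_d μ(d) m/d`
  have hkey : ∑ z : G, (Nat.card {g : G // Subgroup.zpowers (g * z * g⁻¹) = Subgroup.zpowers σ} : ℤ) =
      ∑ d ∈ m.divisors, (ArithmeticFunction.moebius d : ℤ) * (Nat.card G * (m / d : ℕ)) := by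
    simp_rw [← sum_moebius_card_conj]
    rw [Finset.sum_comm]
    refine Finset.sum_congr rfl fun d hd => ?_
    have hdm : d ∣ m := Nat.dvd_of_mem_divisors hd
    have hd0 : d ≠ 0 := Nat.pos_iff_ne_zero.mp (Nat.pos_of_mem_divisors hd)
    rw [← Finset.mul_sum, sum_card_conj_mem, natCard_zpowers_pow hdm hd0]
  -- the left side is `≥ 1` (the term `z = σ`, `g = 1`)
  have hge : (1 : ℤ) ≤ ∑ z : G, (Nat.card {g : G // Subgroup.zpowers (g * z * g⁻¹) = Subgroup.zpowers σ} : ℤ) := by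
    have h1 : (1 : ℤ) ≤ (Nat.card {g : G // Subgroup.zpowers (g * σ * g⁻¹) = Subgroup.zpowers σ} : ℤ) := by
      have : 0 < Nat.card {g : G // Subgroup.zpowers (g * σ * g⁻¹) = Subgroup.zpowers σ} := by
        rw [Nat.card_pos_iff]
        exact ⟨⟨⟨1, by simp⟩⟩, inferInstance⟩
      exact_mod_cast this
    exact h1.trans (Finset.single_le_sum (f := fun z : G =>
      (Nat.card {g : G // Subgroup.zpowers (g * z * g⁻¹) = Subgroup.zpowers σ} : ℤ))
      (fun z _ => by positivity) (Finset.mem_univ σ))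
  rw [hkey] at hge
  -- divide by `m |G|`
  have hreal : (1 : ℝ) ≤ ∑ d ∈ m.divisors, (ArithmeticFunction.moebius d : ℝ) * (Nat.card G * ((m / d : ℕ) : ℝ)) := by
    have h := (Int.cast_le (R := ℝ)).mpr hge
    push_cast at h
    exact h
  have hdiv : ∀ d ∈ m.divisors, ((m / d : ℕ) : ℝ) = (m : ℝ) / d := by
    intro d hd
    rw [Nat.cast_div (Nat.dvd_of_mem_divisors hd)]
    exact_mod_cast (Nat.pos_of_mem_divisors hd).ne'
  have hsum : ∑ d ∈ m.divisors, (ArithmeticFunction.moebius d : ℝ) * (Nat.card G * ((m / d : ℕ) : ℝ)) =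
      (m * Nat.card G) * ∑ d ∈ m.divisors, (ArithmeticFunction.moebius d : ℝ) / d := by
    rw [Finset.mul_sum]
    refine Finset.sum_congr rfl fun d hd => ?_
    rw [hdiv d hd]
    ring
  rw [hsum] at hreal
  rw [div_le_iff₀ (by positivity)]
  linarith

omit [Fintype G] in
/-- **Index two**: if `[G : K] = 2` and `σ ∉ K` then `σ^d ∈ K ↔ d` is even. -/
theorem pow_mem_iff_even_of_index_two {K : Subgroup G} (hK : K.index = 2) {σ : G} (hσ : σ ∉ K)
    (d : ℕ) : σ ^ d ∈ K ↔ Even d := by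
  induction d with
  | zero => simp
  | succ d ih =>
    rw [pow_succ, Subgroup.mul_mem_iff_of_index_two hK, ih, Nat.even_add_one]
    tauto

end GroupTheory

/-! ### The Perlis expansion of the division count -/

section Perlis

variable {N : Type} [Field N] [NumberField N] [IsGalois ℚ N]

/-- **The division weight at an unramified prime**: for `p ∤ d_N` with Frobenius `φ` (trivial inertia),
`Σ_{d ∣ m} (μ(d)/d) · a_{N^{⟨σ^d⟩}}(p) = (1/m) · #{g : ⟨g φ g⁻¹⟩ = ⟨σ⟩}` (`m = ord σ`). -/
theorem divisionWeight_eq (σ : N ≃ₐ[ℚ] N) {p : ℕ} (hp : p.Prime) (Q₀ : Ideal (𝓞 N)) [Q₀.IsMaximal]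
    [Q₀.LiesOver (span {(p : ℤ)})] {φ : N ≃ₐ[ℚ] N} (hφ : IsArithFrobAt ℤ φ Q₀)
    (hI : Q₀.inertia (N ≃ₐ[ℚ] N) = ⊥) :
    ∑ d ∈ (orderOf σ).divisors, (ArithmeticFunction.moebius d : ℝ) / d *
        (((splittingType (IntermediateField.fixedField (Subgroup.zpowers (σ ^ d))) p).count 1 : ℕ) : ℝ) =
      (Nat.card {g : N ≃ₐ[ℚ] N // Subgroup.zpowers (g * φ * g⁻¹) = Subgroup.zpowers σ} : ℝ) /
        orderOf σ := by
  classical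
  set m : ℕ := orderOf σ with hm
  have hm0 : (0 : ℝ) < m := by exact_mod_cast orderOf_pos σ
  -- Perlis: `(m/d) · a_{E_d}(p) = #{g : g φ g⁻¹ ∈ H_d}`
  have ha : ∀ d ∈ m.divisors,
      (((splittingType (IntermediateField.fixedField (Subgroup.zpowers (σ ^ d))) p).count 1 : ℕ) : ℝ) =
        (Nat.card {g : N ≃ₐ[ℚ] N // g * φ * g⁻¹ ∈ Subgroup.zpowers (σ ^ d)} : ℝ) * d / m := by
    intro d hd
    have hdm : d ∣ m := Nat.dvd_of_mem_divisors hd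
    have hd0 : d ≠ 0 := Nat.pos_iff_ne_zero.mp (Nat.pos_of_mem_divisors hd)
    have hk := card_fixingSubgroup_mul_count_one_splittingType
      (IntermediateField.fixedField (Subgroup.zpowers (σ ^ d))) hp Q₀ hφ hI
    rw [natCard_fixingSubgroup_fixedField, natCard_zpowers_pow hdm hd0] at hk
    simp only [IntermediateField.fixingSubgroup_fixedField] at hk
    have hk' : ((m / d : ℕ) : ℝ) *
        (((splittingType (IntermediateField.fixedField (Subgroup.zpowers (σ ^ d))) p).count 1 : ℕ) : ℝ) =
        (Nat.card {g : N ≃ₐ[ℚ] N // g * φ * g⁻¹ ∈ Subgroup.zpowers (σ ^ d)} : ℝ) := by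
      exact_mod_cast hk
    have hmd : ((m / d : ℕ) : ℝ) = (m : ℝ) / d := by
      rw [Nat.cast_div hdm]; exact_mod_cast hd0
    rw [hmd] at hk'
    have hd0' : (0 : ℝ) < d := by exact_mod_cast Nat.pos_of_ne_zero hd0
    field_simp at hk' ⊢
    linarith
  rw [Finset.sum_congr rfl fun d hd => by rw [ha d hd]]
  have hZ := sum_moebius_card_conj σ φ
  have hR : (∑ d ∈ m.divisors, (ArithmeticFunction.moebius d : ℝ) *
      (Nat.card {g : N ≃ₐ[ℚ] N // g * φ * g⁻¹ ∈ Subgroup.zpowers (σ ^ d)} : ℝ)) =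
      (Nat.card {g : N ≃ₐ[ℚ] N // Subgroup.zpowers (g * φ * g⁻¹) = Subgroup.zpowers σ} : ℝ) := by
    exact_mod_cast hZ
  rw [← hR, Finset.sum_div]
  refine Finset.sum_congr rfl fun d hd => ?_
  have hd0 : (d : ℝ) ≠ 0 := by exact_mod_cast (Nat.pos_of_mem_divisors hd).ne'
  field_simp

/-- The division weight is bounded: `Σ_{d ∣ m} (μ(d)/d) a_{E_d}(p) ≤ n²` at every prime (`n = [N:ℚ]`). -/
theorem divisionWeight_le (σ : N ≃ₐ[ℚ] N) {p : ℕ} (hp : p.Prime) :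
    ∑ d ∈ (orderOf σ).divisors, (ArithmeticFunction.moebius d : ℝ) / d *
        (((splittingType (IntermediateField.fixedField (Subgroup.zpowers (σ ^ d))) p).count 1 : ℕ) : ℝ) ≤
      (Module.finrank ℚ N : ℝ) ^ 2 := by
  classical
  set n : ℕ := Module.finrank ℚ N with hn
  -- each term is `≤ n`, and there are `≤ m ≤ n` divisors
  have hterm : ∀ d ∈ (orderOf σ).divisors, (ArithmeticFunction.moebius d : ℝ) / d *
      (((splittingType (IntermediateField.fixedField (Subgroup.zpowers (σ ^ d))) p).count 1 : ℕ) : ℝ) ≤ n := by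
    intro d hd
    have hd1 : (1 : ℝ) ≤ d := by exact_mod_cast Nat.pos_of_mem_divisors hd
    have hμ : |(ArithmeticFunction.moebius d : ℝ)| ≤ 1 := by
      have := ArithmeticFunction.abs_moebius_le_one (n := d)
      exact_mod_cast this
    have hcount : (((splittingType (IntermediateField.fixedField (Subgroup.zpowers (σ ^ d))) p).count 1 : ℕ) : ℝ)
        ≤ n := by
      have h1 := count_one_splittingType_le_finrank (K := IntermediateField.fixedField (Subgroup.zpowers (σ ^ d))) hp
      have h2 : Module.finrank ℚ (IntermediateField.fixedField (Subgroup.zpowers (σ ^ d))) ≤ n := by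
        have h3 := Module.finrank_mul_finrank ℚ (IntermediateField.fixedField (Subgroup.zpowers (σ ^ d))) N
        have hpos : 0 < Module.finrank (IntermediateField.fixedField (Subgroup.zpowers (σ ^ d))) N :=
          Module.finrank_pos
        rw [hn, ← h3]
        exact Nat.le_mul_of_pos_right _ hpos
      exact_mod_cast h1.trans h2
    have hc0 : (0 : ℝ) ≤ (((splittingType (IntermediateField.fixedField (Subgroup.zpowers (σ ^ d))) p).count 1 : ℕ) : ℝ) :=
      Nat.cast_nonneg _
    have hμd : (ArithmeticFunction.moebius d : ℝ) / d ≤ 1 := by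
      rw [div_le_one (by linarith)]
      exact le_trans (le_abs_self _) (hμ.trans hd1)
    calc (ArithmeticFunction.moebius d : ℝ) / d *
          (((splittingType (IntermediateField.fixedField (Subgroup.zpowers (σ ^ d))) p).count 1 : ℕ) : ℝ)
        ≤ 1 * (((splittingType (IntermediateField.fixedField (Subgroup.zpowers (σ ^ d))) p).count 1 : ℕ) : ℝ) :=
          mul_le_mul_of_nonneg_right hμd hc0
      _ ≤ n := by rw [one_mul]; exact hcount
  have hcard : ((orderOf σ).divisors.card : ℝ) ≤ n := by
    have h1 : (orderOf σ).divisors.card ≤ orderOf σ := Nat.card_divisors_le_self _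
    have h2 : orderOf σ ≤ n := by
      rw [hn, ← IsGalois.card_aut_eq_finrank, Nat.card_eq_fintype_card]
      exact orderOf_le_card_univ
    exact_mod_cast h1.trans h2
  have hn0 : (0 : ℝ) ≤ n := Nat.cast_nonneg _
  calc ∑ d ∈ (orderOf σ).divisors, (ArithmeticFunction.moebius d : ℝ) / d *
        (((splittingType (IntermediateField.fixedField (Subgroup.zpowers (σ ^ d))) p).count 1 : ℕ) : ℝ)
      ≤ ∑ _d ∈ (orderOf σ).divisors, (n : ℝ) := Finset.sum_le_sum hterm
    _ = (orderOf σ).divisors.card * n := by rw [Finset.sum_const, nsmul_eq_mul]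
    _ ≤ n * n := mul_le_mul_of_nonneg_right hcard hn0
    _ = (n : ℝ) ^ 2 := by ring

open scoped Classical in
/-- **The summed division count** (Frobenius' device, summed against `log p`): for every `x`,
`Σ_{d ∣ m} (μ(d)/d) θ¹_{N^{⟨σ^d⟩}}(x) − n² log|d_N| ≤ n² · Σ_{p ≤ x, p ∤ d_N, Frob_p generates a conjugate of ⟨σ⟩} log p`,
where the last condition means: some prime `Q ∣ p` of `N` with trivial inertia has an arithmetic Frobenius
`φ` with `⟨g φ g⁻¹⟩ = ⟨σ⟩` for some `g`. -/
theorem division_sum_le (σ : N ≃ₐ[ℚ] N) (x : ℝ) :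
    ∑ d ∈ (orderOf σ).divisors, (ArithmeticFunction.moebius d : ℝ) / d *
        degreeOneTheta (IntermediateField.fixedField (Subgroup.zpowers (σ ^ d))) x -
        (Module.finrank ℚ N : ℝ) ^ 2 * Real.log ((NumberField.discr N).natAbs : ℝ) ≤
      (Module.finrank ℚ N : ℝ) ^ 2 * ∑ p ∈ (Nat.primesLE ⌊x⌋₊).filter
        (fun p : ℕ => ¬ ((p : ℤ) ∣ NumberField.discr N) ∧
          ∃ (Q : Ideal (𝓞 N)) (_ : Q.IsMaximal) (_ : Q.LiesOver (span {(p : ℤ)})) (φ g : N ≃ₐ[ℚ] N),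
            IsArithFrobAt ℤ φ Q ∧ Q.inertia (N ≃ₐ[ℚ] N) = ⊥ ∧
              Subgroup.zpowers (g * φ * g⁻¹) = Subgroup.zpowers σ), Real.log p := by
  classical
  set n : ℕ := Module.finrank ℚ N with hn
  set u : ℕ → ℝ := fun p => ∑ d ∈ (orderOf σ).divisors, (ArithmeticFunction.moebius d : ℝ) / d *
    (((splittingType (IntermediateField.fixedField (Subgroup.zpowers (σ ^ d))) p).count 1 : ℕ) : ℝ) with hu
  have hc0 : (0 : ℝ) ≤ (n : ℝ) ^ 2 := by positivity
  have h := sum_le_of_pointwise (N := N) ((n : ℝ) ^ 2) hc0 u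
    (fun p => ∃ (Q : Ideal (𝓞 N)) (_ : Q.IsMaximal) (_ : Q.LiesOver (span {(p : ℤ)})) (φ g : N ≃ₐ[ℚ] N),
      IsArithFrobAt ℤ φ Q ∧ Q.inertia (N ≃ₐ[ℚ] N) = ⊥ ∧ Subgroup.zpowers (g * φ * g⁻¹) = Subgroup.zpowers σ)
    ⌊x⌋₊ ?_ ?_
  · -- rewrite the left side as `Σ_p u(p) log p`
    refine le_trans (le_of_eq ?_) h
    congr 1
    simp_rw [degreeOneTheta_eq_sum_count_one, Finset.mul_sum, hu, Finset.sum_mul]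
    rw [Finset.sum_comm]
    refine Finset.sum_congr rfl fun p _ => Finset.sum_congr rfl fun d _ => by ring
  · -- unramified primes: `u(p) = (1/m) #{g : ⟨g φ g⁻¹⟩ = ⟨σ⟩}`
    intro p hp hd
    have hp' := (Nat.mem_primesLE.mp hp).2
    obtain ⟨Q₀, hQ₀max, hQ₀over, ⟨φ, hφ⟩, hI⟩ := exists_isArithFrobAt_of_not_dvd_discr (N := N) hp' hd
    have hw : u p = (Nat.card {g : N ≃ₐ[ℚ] N // Subgroup.zpowers (g * φ * g⁻¹) = Subgroup.zpowers σ} : ℝ) /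
        orderOf σ := divisionWeight_eq σ hp' Q₀ hφ hI
    by_cases hpos : 0 < Nat.card {g : N ≃ₐ[ℚ] N // Subgroup.zpowers (g * φ * g⁻¹) = Subgroup.zpowers σ}
    · obtain ⟨⟨g, hg⟩⟩ := (Nat.card_pos_iff.mp hpos).1
      rw [if_pos ⟨Q₀, hQ₀max, hQ₀over, φ, g, hφ, hI, hg⟩, mul_one]
      exact divisionWeight_le σ hp'
    · have h0 : Nat.card {g : N ≃ₐ[ℚ] N // Subgroup.zpowers (g * φ * g⁻¹) = Subgroup.zpowers σ} = 0 := by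
        omega
      rw [hw, h0, Nat.cast_zero, zero_div]
      positivity
  · intro p hp _
    exact divisionWeight_le σ (Nat.mem_primesLE.mp hp).2

end Perlis

end Summit.QuantumAdvantage.QuantumAdvantage.Theorems.DegreeOnePrimesEscape

end
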